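import Mathlib
import Summits.Langlands.Langlands.Theses.IrreducibilityBySelfDuality
import Literature.NumberTheory.Automorphic.ClozelAlgebraicity
import Literature.NumberTheory.Automorphic.GLOneOfHeckeCharacterBJ
import Literature.NumberTheory.Automorphic.GLnAdelicStructureProofs
import Literature.NumberTheory.Automorphic.JacquetLanglandsParts
import Literature.NumberTheory.GaloisRepresentations.HeckeLFunctionNonvanishingLineProofs

/-!
# `HeckeEigenvalueField` (stmt-Langlands-13632): the hypothesis `IsRegularAlgebraic` is
# load-bearing — negative lemmas (refuter, cdisprove cycle 1; `--supports` file, theorems only)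

The crux `Summit.Langlands.Langlands.Theses.IrreducibilityBySelfDuality.HeckeEigenvalueField`
(= `Literature.NumberTheory.Automorphic.Clozel1990_heckeEigenvalueField`, Clozel 1990 Thm. 3.13 in
Hecke-eigenvalue form) asserts, for `π` cuspidal REGULAR ALGEBRAIC on `GL_n(𝔸_K)`, one number field
containing the unramified Hecke eigenvalues `t_{v,i} = q_v^{i(n-i)/2} e_i(α_v)` at almost all `v`.
This file proves, sorry-free and on the crux's own carriers, that the algebraicity hypothesis cannot
be dropped — neither from the crux nor from stub (S4) of the picked line `BaireSketch`
(`Cruxes/HeckeEigenvalueField/Lines/BaireSketch.lean`, `stub_S4`: countability of the cofinite germs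
of unramified Hecke eigensystems):

* `exists_cuspidal_glOne_normPow` — the WITNESS FAMILY: for every number field `K` and `z ∈ ℂ` the
  Borel–Jacquet datum of the norm power `‖·‖^z` (tree: `HeckeCharacter.exists_forall_apply_eq_ideleNorm_cpow`,
  `exists_automorphicRepData_detTwist_glOne`) is a CUSPIDAL datum on `GL_1(𝔸_K)` with Satake
  parameter `{N(v)^{-z}}` at all but finitely many `v` (`hasSatakeParamAt_detTwist_glOne`,
  `valueAtUniformizer_of_forall_apply_eq_cpow`).
* `heckeEigenvalueField_false_without_isRegularAlgebraic` — the crux text with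
  `π.1.IsRegularAlgebraic →` deleted is FALSE: `n = 1`, `K = ℚ`, `π = π_{‖·‖^s}` with `s ∈ ℝ` chosen
  (by counting: algebraic numbers are countable, `s ↦ q^{-s}` is injective) so that `q^{-s}` is
  transcendental for every `q ≥ 2`; then `t_{v,1} = N(v)^{-s}` lies in no number field at any `v`.
* `stub_S4_false_without_isRegularAlgebraic` — stub (S4) with `π.1.IsRegularAlgebraic →` deleted is
  FALSE: the germs `v ↦ N(v)^{-s}`, `s ∈ ℝ`, are pairwise distinct at every place, so `s ↦` (the
  member of the countable family shadowing `π_s`) injects `ℝ` into a countable set.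

Reading for the provers: any proof of the crux / of (S4) must route `IsRegularAlgebraic` (through the
infinitesimal character pinned by the Harish-Chandra homomorphism, `HasArchParameter`) into the
argument; Harish-Chandra finiteness at a level alone does not bound the family of cuspidal data, the
`|det|^s`-twists being unramified everywhere of every level. This is the `|·|^s` obstruction of
Clozel 1990, §1 and Buzzard–Gee 2014, §3.1, realised in the tree's `GL(1)` model; no new named fact.
-/

open scoped Classical
open Filter NumberField IsDedekindDomain
open Literature.NumberTheory.Automorphic Literature.NumberTheory.GaloisRepresentations

namespace Summit.Langlands.Langlands.Theorems.HeckeEigenvalueField.Negative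


/-! ## The witness family: the cuspidal `GL(1)` data of the norm powers `‖·‖^z` -/

/-- **Norm-power data on `GL(1)`.** For every number field `K`, level witness `hcpt` and `z ∈ ℂ`,
the Borel–Jacquet datum `π_z = ℂ·(‖det‖^z)/⊥` of the Hecke character `‖·‖^z`
(`HeckeCharacter.exists_forall_apply_eq_ideleNorm_cpow`, `exists_automorphicRepData_detTwist_glOne`)
is CUSPIDAL (rank one: no proper parabolic) and has Satake parameter `{N(v)^{-z}}` at all but
finitely many finite places (`hasSatakeParamAt_detTwist_glOne`,
`valueAtUniformizer_of_forall_apply_eq_cpow`). [folklore] -/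
theorem exists_cuspidal_glOne_normPow (K : Type) [Field K] [NumberField K]
    (hcpt : isCompact_glFiniteIntegralLevel 1 K) (z : ℂ) :
    ∃ π : CuspidalAutomorphicRepData 1 K hcpt,
      ∀ᶠ v : HeightOneSpectrum (𝓞 K) in cofinite,
        π.1.HasSatakeParamAt v {((Ideal.absNorm v.asIdeal : ℕ) : ℂ) ^ (-z)} := by
  obtain ⟨ν, hν⟩ := HeckeCharacter.exists_forall_apply_eq_ideleNorm_cpow K z
  obtain ⟨π, hW, hW'⟩ := exists_automorphicRepData_detTwist_glOne hcpt ν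
  have hcusp : π.W ≤ cuspFormsGL 1 K hcpt := by
    rw [hW, Submodule.span_le, Set.singleton_subset_iff]
    exact IsCuspFormGL.mem_cuspFormsGL
      ⟨isAutomorphicForm_detTwist_glOne hcpt ν, fun k hk hk1 => absurd hk1 (by omega)⟩
  refine ⟨⟨π, hcusp⟩, ?_⟩
  obtain ⟨𝔪, h𝔪, hν𝔪⟩ := ν.exists_level_glOne
  filter_upwards [(Ideal.finite_factors h𝔪).eventually_cofinite_notMem] with v hv
  have h := AutomorphicRepData.hasSatakeParamAt_detTwist_glOne hcpt hW hW' h𝔪 hν𝔪 v hv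
    (HeckeCharacter.valued_uniformizer (K := K) v)
  have hval : (((ν (localUnits v (HeckeCharacter.uniformizer K v)) : ℂˣ) : ℂ)) =
      ((Ideal.absNorm v.asIdeal : ℕ) : ℂ) ^ (-z) :=
    HeckeCharacter.valueAtUniformizer_of_forall_apply_eq_cpow hν v
  rw [hval] at h
  exact h

/-- The rank-one Hecke eigenvalue of a singleton Satake parameter, in the crux's inlined
normalisation: `(√q_v)^{1·(1-1)} · e_1({c}) = c`. [folklore] -/
theorem sqrt_pow_mul_esymm_singleton_one (x : ℝ) (c : ℂ) :
    ((x : ℂ) ^ (1 * (1 - 1))) * ({c} : Multiset ℂ).esymm 1 = c := by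
  simp [Multiset.esymm, Multiset.powersetCard_one]

/-- `heckeEigenvalueOf 1 v {c} 1 = c`. [folklore] -/
theorem heckeEigenvalueOf_one_singleton_one' {K : Type} [Field K] [NumberField K]
    (v : HeightOneSpectrum (𝓞 K)) (c : ℂ) : heckeEigenvalueOf 1 v {c} 1 = c := by
  simp [heckeEigenvalueOf, Multiset.esymm, Multiset.powersetCard_one]

/-- The residue cardinality of a finite place of a number field is at least `2`
(`N(v) ≠ 0, 1` for a non-zero prime `v`). [folklore] -/
theorem two_le_absNorm {K : Type} [Field K] [NumberField K] (v : HeightOneSpectrum (𝓞 K)) :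
    2 ≤ Ideal.absNorm v.asIdeal := by
  have h0 : Ideal.absNorm v.asIdeal ≠ 0 := by
    rw [Ne, Ideal.absNorm_eq_zero_iff]
    exact v.ne_bot
  have h1 : Ideal.absNorm v.asIdeal ≠ 1 := by
    rw [Ne, Ideal.absNorm_eq_one_iff]
    exact v.isPrime.ne_top
  omega

/-- **A real exponent `s` with `q^{-s}` transcendental for every integer `q ≥ 2`** (for each
`q` the map `s ↦ q^{-s}` is injective and the algebraic numbers are countable, while `ℝ` is not).
[folklore] -/
theorem exists_real_forall_not_isAlgebraic_rpow :
    ∃ s : ℝ, ∀ q : ℕ, 2 ≤ q → ¬ IsAlgebraic ℚ ((((q : ℝ) ^ (-s) : ℝ)) : ℂ) := by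
  let B : Set ℝ := ⋃ q : ℕ, ⋃ (_ : 2 ≤ q),
    (fun s : ℝ => ((((q : ℝ) ^ (-s) : ℝ)) : ℂ)) ⁻¹' {x : ℂ | IsAlgebraic ℚ x}
  -- the algebraic numbers are countable (Cantor; Mathlib's `Algebra.IsAlgebraic.cardinalMk_le_max`)
  have hA : {x : ℂ | IsAlgebraic ℚ x}.Countable := by
    have h := @Algebra.IsAlgebraic.cardinalMk_le_max ℚ _ _ (algebraicClosure ℚ ℂ) _ _
      (algebraicClosure ℚ ℂ).algebra _ (algebraicClosure.isAlgebraic ℚ ℂ)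
    have h' : Cardinal.mk (algebraicClosure ℚ ℂ) ≤ Cardinal.aleph0 := by simpa using h
    have hc : ((algebraicClosure ℚ ℂ : IntermediateField ℚ ℂ) : Set ℂ).Countable :=
      Cardinal.le_aleph0_iff_set_countable.mp h'
    convert hc using 1
    ext x
    simp [mem_algebraicClosure_iff]
  have hB : B.Countable := by
    refine Set.countable_iUnion fun q => Set.countable_iUnion fun hq => ?_
    refine hA.preimage fun s t hst => ?_
    have h1 : (1 : ℝ) < q := by exact_mod_cast hq
    have hst' : (q : ℝ) ^ (-s) = (q : ℝ) ^ (-t) := Complex.ofReal_injective hst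
    have hmono : StrictMono fun y : ℝ => (q : ℝ) ^ y := fun y y' hy =>
      Real.rpow_lt_rpow_of_exponent_lt h1 hy
    exact neg_injective (hmono.injective hst')
  obtain ⟨s, hs⟩ : ∃ s, s ∉ B := by
    by_contra hall
    exact Cardinal.not_countable_real (hB.mono fun s _ => not_not.mp (not_exists.mp hall s))
  refine ⟨s, fun q hq halg => hs ?_⟩
  exact Set.mem_iUnion.2 ⟨q, Set.mem_iUnion.2 ⟨hq, halg⟩⟩

/-- Elements of a subfield of `ℂ` finite over `ℚ` are algebraic. [folklore] -/
theorem isAlgebraic_of_mem_of_finiteDimensional {E : Subfield ℂ} [FiniteDimensional ℚ E]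
    {x : ℂ} (hx : x ∈ E) : IsAlgebraic ℚ x := by
  have h1 : IsAlgebraic ℚ (⟨x, hx⟩ : E) := Algebra.IsAlgebraic.isAlgebraic _
  exact h1.algebraMap (A := ℂ)

/-! ## The crux without `IsRegularAlgebraic` is false -/

/-- **Any proof of the crux must use `IsRegularAlgebraic`**: without it the statement fails
already for `n = 1`, `K = ℚ`, at the cuspidal datum of `‖·‖^s` with `s` real and `q^{-s}`
transcendental for every `q ≥ 2` — its Hecke eigenvalue at every unramified `v` is
`t_{v,1} = N(v)^{-s}`, which lies in no number field. (The `|det|^s`-twist obstruction of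
Clozel 1990, §1 / Buzzard–Gee 2014, §3.1, realised in the tree's Borel–Jacquet `GL(1)` model.)
[folklore] -/
theorem heckeEigenvalueField_false_without_isRegularAlgebraic :
    ¬ ∀ (n : ℕ) (K : Type) [Field K] [NumberField K] (hcpt : _)
        (π : Literature.NumberTheory.Automorphic.CuspidalAutomorphicRepData n K hcpt),
        ∃ E : Subfield ℂ, FiniteDimensional ℚ E ∧ ∀ᶠ v in cofinite, ∀ α : Multiset ℂ,
          π.1.HasSatakeParamAt v α → ∀ i ≤ n,
            ((((Real.sqrt (v.residueCard : ℝ)) : ℝ) : ℂ) ^ (i * (n - i))) * α.esymm i ∈ E := by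
  intro h
  obtain ⟨s, hs⟩ := exists_real_forall_not_isAlgebraic_rpow
  have hcpt : isCompact_glFiniteIntegralLevel 1 ℚ := isCompact_glFiniteIntegralLevel_holds 1 ℚ
  obtain ⟨π, hπ⟩ := exists_cuspidal_glOne_normPow ℚ hcpt (s : ℂ)
  obtain ⟨E, hE, hev⟩ := h 1 ℚ hcpt π
  haveI := infinite_heightOneSpectrum ℚ
  obtain ⟨v, hv1, hv2⟩ := (hπ.and hev).exists
  have hmem := hv2 _ hv1 1 le_rfl
  rw [sqrt_pow_mul_esymm_singleton_one] at hmem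
  have halg : IsAlgebraic ℚ (((Ideal.absNorm v.asIdeal : ℕ) : ℂ) ^ (-(s : ℂ))) :=
    isAlgebraic_of_mem_of_finiteDimensional hmem
  refine hs _ (two_le_absNorm v) ?_
  rwa [Complex.ofReal_cpow (Nat.cast_nonneg _), Complex.ofReal_natCast, Complex.ofReal_neg]

/-! ## Stub (S4) of line `BaireSketch` without `IsRegularAlgebraic` is false -/

/-- **(S4) needs `IsRegularAlgebraic`**: without it the germs are UNCOUNTABLE already for
`n = 1`, `K = ℚ` — the data of `‖·‖^s`, `s ∈ ℝ`, have eigensystems `v ↦ N(v)^{-s}` that are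
pairwise distinct at EVERY place, so `s ↦` (the member of `𝒞` shadowing `π_s`) is an injection
of `ℝ` into a countable set. Any proof of `stub_S4` must therefore route the algebraicity of the
infinity type into the countability (e.g. through the infinitesimal character, as the line
intends); Harish-Chandra finiteness at a FIXED ideal of `Z(𝔤)` alone does not bound the family.
[folklore] -/
theorem stub_S4_false_without_isRegularAlgebraic :
    ¬ ∀ (n : ℕ) (K : Type) [Field K] [NumberField K]
        (hcpt : isCompact_glFiniteIntegralLevel n K),
        ∃ 𝒞 : Set (HeightOneSpectrum (𝓞 K) × Fin (n + 1) → ℂ), 𝒞.Countable ∧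
          ∀ π : CuspidalAutomorphicRepData n K hcpt,
            ∃ c ∈ 𝒞, ∀ᶠ v in cofinite, ∀ α : Multiset ℂ, π.1.HasSatakeParamAt v α →
              ∀ i : Fin (n + 1), heckeEigenvalueOf n v α i = c (v, i) := by
  intro h
  have hcpt : isCompact_glFiniteIntegralLevel 1 ℚ := isCompact_glFiniteIntegralLevel_holds 1 ℚ
  obtain ⟨𝒞, h𝒞, hπ𝒞⟩ := h 1 ℚ hcpt
  haveI := infinite_heightOneSpectrum ℚ
  haveI : Countable 𝒞 := h𝒞.to_subtype
  -- the datum of `‖·‖^s` and its shadow in `𝒞`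
  choose π hπ using fun s : ℝ => exists_cuspidal_glOne_normPow ℚ hcpt (s : ℂ)
  choose c hc hcπ using fun s : ℝ => hπ𝒞 (π s)
  have hinj : Function.Injective fun s : ℝ => (⟨c s, hc s⟩ : 𝒞) := by
    intro s t hst
    have hct : c s = c t := congrArg Subtype.val hst
    obtain ⟨v, hvs, hvt, hcs, hcv⟩ := ((hπ s).and ((hπ t).and ((hcπ s).and (hcπ t)))).exists
    have h1 := hcs _ hvs 1
    have h2 := hcv _ hvt 1
    rw [show ((1 : Fin (1 + 1)) : ℕ) = 1 from rfl, heckeEigenvalueOf_one_singleton_one'] at h1 h2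
    have h12 : ((Ideal.absNorm v.asIdeal : ℕ) : ℂ) ^ (-(s : ℂ)) =
        ((Ideal.absNorm v.asIdeal : ℕ) : ℂ) ^ (-(t : ℂ)) := by rw [h1, h2, hct]
    rw [← Complex.ofReal_neg, ← Complex.ofReal_neg, ← Complex.ofReal_natCast,
      ← Complex.ofReal_cpow (Nat.cast_nonneg _), ← Complex.ofReal_cpow (Nat.cast_nonneg _)] at h12
    have h12' : (Ideal.absNorm v.asIdeal : ℝ) ^ (-s) = (Ideal.absNorm v.asIdeal : ℝ) ^ (-t) :=
      Complex.ofReal_injective h12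
    have hq : (1 : ℝ) < (Ideal.absNorm v.asIdeal : ℕ) := by exact_mod_cast two_le_absNorm v
    have hmono : StrictMono fun y : ℝ => ((Ideal.absNorm v.asIdeal : ℕ) : ℝ) ^ y :=
      fun y y' hy => Real.rpow_lt_rpow_of_exponent_lt hq hy
    exact neg_injective (hmono.injective h12')
  haveI : Countable ℝ := hinj.countable
  exact Cardinal.not_countable_real (Set.countable_univ)

end Summit.Langlands.Langlands.Theorems.HeckeEigenvalueField.Negative
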